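import Literature.AlgebraicGeometry.Motives.AlgPointsHolomorphicFamiliesAffine
import Literature.AlgebraicGeometry.Motives.AbelianVarietyComplexPoints
import Literature.AlgebraicGeometry.ShimuraVarieties.HeckeCorrespondenceAction
import Literature.AlgebraicGeometry.ShimuraVarieties.UnitaryBallLevelFiniteCover
import Literature.AlgebraicGeometry.ShimuraVarieties.UnitaryBallLocalBiholomorphy
import Literature.AlgebraicTopology.SingularHomology.FiniteCoverNorm
import Literature.NumberTheory.Transcendental.AnalytificationMorphisms
import HarnessLib

/-!
# The norm of a map to an abelian variety along a level covering of ball quotients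

Let `D₁ : UnitaryBallUniformisationDatum 2 X₁`, `D₂ : UnitaryBallUniformisationDatum 2 X₂` be two torsion-free
unitary ball-quotient data with the SAME hermitian space (`D₁.Hℂ = D₂.Hℂ`) and let
`f : X₁(ℂ) → X₂(ℂ)` intertwine the uniformizations (`f (unif₁ v) = unif₂ v` on the negative cone) —
the shape of the level map `Γ₁ \ 𝔹² → Γ₂ \ 𝔹²` of a pair of levels `Γ₁ ≤ Γ₂`; by
`UnitaryBallLevelFiniteCover.lean` `f` is a finite covering (`IsFiniteCover f`). For a continuous
map `Φ : X₁(ℂ) → G` to a commutative topological group the NORM of `Φ` along `f` is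
`N_f Φ (b) = ∏_{f e = b} Φ e` (`IsFiniteCover.normMap`, `FiniteCoverNorm.lean`). We prove:

* `mem_preimage_unif_iff` — **the fibre of the level covering** over `unif₂ v` is the finite set
  `{unif₁ (γ • v) : γ ∈ Γ₂}` (the orbit description `X(ℂ) = Γ \ 𝔹` of both quotients,
  `unif_eq_unif_iff`);
* `normMap_unif_eventuallyEq` — **the local coset formula**: choosing `γ_e ∈ Γ₂` with
  `unif₁ (γ_e • v₀) = e` for the points `e` of the fibre over `unif₂ v₀`, one has, for `v` near
  `v₀`,

  `N_f Φ (unif₂ v) = ∏_{e ∈ f⁻¹(unif₂ v₀)} Φ (unif₁ (γ_e • v))`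

  (the points `unif₁ (γ_e • v)` lie in the fibre over `unif₂ v`, stay pairwise distinct near `v₀`
  by continuity and Hausdorffness, and exhaust the fibre because the number of sheets is constant,
  `IsFiniteCover.card_fibre_eq`). This is the analytic description of the norm as the product over
  the cosets `Γ₁ \ Γ₂` of the translates of `Φ ∘ unif₁`, written without choosing coset
  representatives globally;
* `IsFiniteCover.sheets_eq_ncard_fibre` — over a preconnected base the number of sheets
  (`IsFiniteCover.sheets`, an infimum) is the cardinality of any fibre; hence
  `sheets_smul_transferMap_map` — **the transfer in `H¹(–; ℚ)` along `f` is induced by the norm**: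
  `[X₁(ℂ) : X₂(ℂ)] • τ (Φ^* a) = (N_f Φ)^* a` for `a ∈ H¹(G; ℚ)`, `G` a path-connected commutative
  topological group (`FiniteCoverNorm.lean`, Hatcher §3.G, for the present covering);
* `mdifferentiable_normAn` — for a morphism `F : X₁ ⟶ A` to a complex abelian variety, the norm
  `N_f F(ℂ) : X₂(ℂ) → A(ℂ)`, read in Hodge models (analytifications) of `X₂` and `A`, is
  **holomorphic**: locally it is the finite product, in the commutative group scheme `A`, of the
  holomorphic families `v ↦ F(unif₁(γ_e • v))` (`differentiableOn_unif` and the affine criterion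
  `AlgPoints.isHolFamilyOn_of_differentiableOn_evalOrZero`, `IsHolFamilyOn.finsetProd`; Serre,
  GAGA §2 n°5, Mumford §1 (1)), and holomorphy into `A^an` is tested on regular functions
  (`IsAnalytification.mdifferentiableAt_of_comp_regular`, GAGA §2 n°6);
* `exists_hom_eq_normMap`, `normHom`, `mapContinuous_normHom` — hence, under the record
  `Arapura2012_Cor_15_4_6` (a holomorphic map between nonsingular projective varieties is a
  morphism; `X₂` is smooth projective by the datum, `A` by
  `AbelianVariety.isSmoothProjective_holds`), **the norm is a morphism** `N_f F : X₂ ⟶ A` with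
  `(N_f F)(ℂ) = N_f (F(ℂ))`, and `sheets_smul_transferMap_pull_eq` —
  `[X₁(ℂ) : X₂(ℂ)] • τ (F(ℂ)^* a) = (N_f F)(ℂ)^* a` on `H¹(A(ℂ); ℚ)`.

Mathematical sources: the tower of compact ball quotients `S(Γ)` and its level maps —
Bergeron–Millson–Moeglin 2016, Introduction §1.1 and Part 2 §1.3; the norm (trace) of a map to a
commutative group along a finite covering — Mumford, *Abelian Varieties* §6, Fulton Ex. 1.7.4;
transfer — Hatcher §3.G; GAGA — Serre 1956 §2, Arapura 2012 Cor. 15.4.6. Everything in this file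
is a THEOREM over the tree's definitions (the one cited record, `Arapura2012_Cor_15_4_6`, enters as
an explicit hypothesis); no named fact is introduced.

Written under the LEAN-IN-TREE rule for the pub-hodgecm formalisation cell (model-construction
sub-cell, seat mc-axioms-1 gen 8, MODEL-DAG node N-i1: the norm half of the Betti push-forward
along a change of level). Nothing in this file is a claim of the manuscripts adjudicated by that
cell.

## References

* N. Bergeron, J. Millson, C. Moeglin, *The Hodge conjecture and arithmetic quotients of complex
  balls*, Acta Math. 216 (2016), Introduction §1.1, Part 2 §1.2–1.3.
  [BergeronMillsonMoeglin2016Balls]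
* D. Mumford, *Abelian Varieties*, Oxford 1970, §1 (1), §6. [MumfordAV1970]
* A. Hatcher, *Algebraic Topology*, CUP 2002, §1.3 p. 61, §3.G Prop. 3G.1. [HatcherAT2002]
* J.-P. Serre, *Géométrie algébrique et géométrie analytique*, Ann. Inst. Fourier 6 (1956), §2
  n°5–6. [SerreGAGA1956]
* D. Arapura, *Algebraic Geometry over the Complex Numbers*, Springer 2012, Cor. 15.4.6.
  [Arapura2012]
* K. Fritzsche, H. Grauert, *From Holomorphic Functions to Complex Manifolds*, GTM 213 (2002),
  Ch. I §8 Cor. 8.6. [FritzscheGrauert2002]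
-/

set_option autoImplicit false

noncomputable section

open Matrix Complex CategoryTheory AlgebraicGeometry Topology Filter
open scoped Manifold ContDiff
open Literature.Geometry.ComplexHyperbolic
open Literature.Geometry.ComplexHyperbolic.BallModel
open Literature.AlgebraicTopology.SingularHomology
open Literature.AlgebraicGeometry.Motives
open Literature.AlgebraicGeometry.HodgeTheory (HodgeModel)
open Literature.NumberTheory.Transcendental

universe u

/-! ### The number of sheets over a preconnected base -/

namespace Literature.AlgebraicTopology.SingularHomology.IsFiniteCover

variable {E B : Type u} [TopologicalSpace E] [TopologicalSpace B] {proj : C(E, B)}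
  (c : IsFiniteCover proj)

/-- **Over a preconnected base the number of sheets is the cardinality of every fibre** (the
infimum `IsFiniteCover.sheets` of the locally constant function `b ↦ #p⁻¹(b)` is attained
everywhere). [cite: HatcherAT2002, §1.3 p. 61] -/
theorem sheets_eq_ncard_fibre [PreconnectedSpace B] (b : B) : c.sheets = (proj ⁻¹' {b}).ncard := by
  haveI : Nonempty B := ⟨b⟩
  exact le_antisymm (c.sheets_le b) (le_ciInf fun b' ↦ (c.ncard_fibre_eq b b').le)

/-- `Finset` form: the number of sheets is `#(c.fibre b)`. [cite: HatcherAT2002, §1.3 p. 61] -/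
theorem sheets_eq_card_fibre [PreconnectedSpace B] (b : B) : c.sheets = (c.fibre b).card := by
  rw [card_fibre, c.sheets_eq_ncard_fibre b]

/-- **The transfer in `H¹(–; ℚ)` is induced by the norm**, with the number of sheets as the scalar:
`[E : B] • τ(F^* a) = (N_p F)^* a`. [cite: HatcherAT2002, §3.G p. 321] -/
theorem sheets_smul_transferMap_map [PathConnectedSpace B] {G : Type u} [TopologicalSpace G]
    [CommGroup G] [IsTopologicalGroup G] [PathConnectedSpace G] (F : C(E, G)) (b : B)
    (a : singularCohomology ℚ ℚ G 1) :
    (c.sheets : ℚ) • c.transferMap (R := ℚ) 1 (singularCohomology.map ℚ ℚ F 1 a) =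
      singularCohomology.map ℚ ℚ (c.normMap F) 1 a := by
  rw [c.sheets_eq_ncard_fibre b]
  exact c.ncard_fibre_smul_transferMap_map F b a

end Literature.AlgebraicTopology.SingularHomology.IsFiniteCover

namespace Literature.AlgebraicGeometry.ShimuraVarieties

namespace UnitaryBallUniformisationDatum

variable {X₁ X₂ : SchemeOver ℂ} {D₁ : UnitaryBallUniformisationDatum 2 X₁}
  {D₂ : UnitaryBallUniformisationDatum 2 X₂}

/-! ### The action of `GL₃(E)` on `ℂ³` through `τ₁` (bookkeeping) -/

section Action

variable {p : ℕ} {X : SchemeOver ℂ} (D : UnitaryBallUniformisationDatum p X)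

/-- `1 • v = v` for the matrix action `D.act` (`(γ.map τ₁) *ᵥ v`). [folklore] -/
private lemma act_one_vec (v : Fin (p + 1) → ℂ) : D.act 1 v = v := by
  simp only [UnitaryBallUniformisationDatum.act, Units.val_one,
    Matrix.map_one D.τ₁ (map_zero _) (map_one _),
    Matrix.one_mulVec]

/-- `(γδ) • v = γ • (δ • v)` for the matrix action `D.act`. [folklore] -/
private lemma act_mul_vec (γ δ : GL (Fin (p + 1)) D.E) (v : Fin (p + 1) → ℂ) :
    D.act (γ * δ) v = D.act γ (D.act δ v) := by
  simp only [UnitaryBallUniformisationDatum.act, Units.val_mul, Matrix.map_mul, Matrix.mulVec_mulVec]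

/-- `γ • (a v) = a (γ • v)`: the action `D.act γ` is `ℂ`-linear. [folklore] -/
private lemma act_smul_vec (γ : GL (Fin (p + 1)) D.E) (a : ℂ) (v : Fin (p + 1) → ℂ) :
    D.act γ (a • v) = a • D.act γ v :=
  Matrix.mulVec_smul _ _ _

/-- `γ⁻¹ • (γ • v) = v`. [folklore] -/
private lemma act_inv_act (γ : GL (Fin (p + 1)) D.E) (v : Fin (p + 1) → ℂ) :
    D.act γ⁻¹ (D.act γ v) = v := by
  rw [← act_mul_vec, inv_mul_cancel, act_one_vec]

/-- `v ↦ γ • v` is continuous (a linear map of `ℂ^{p+1}`). [folklore] -/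
private lemma continuous_act_vec (γ : GL (Fin (p + 1)) D.E) : Continuous (D.act γ) :=
  Continuous.matrix_mulVec continuous_const continuous_id

/-- `v ↦ γ • v` is complex-differentiable (a `ℂ`-linear map of `ℂ^{p+1}`). [folklore] -/
private lemma differentiable_act_vec (γ : GL (Fin (p + 1)) D.E) : Differentiable ℂ (D.act γ) :=
  (LinearMap.toContinuousLinearMap
    (Matrix.mulVecLin (((γ : Matrix (Fin (p + 1)) (Fin (p + 1)) D.E)).map D.τ₁))).differentiable

/-- `unif` is continuous at every point of the (open) negative cone. [folklore] -/
private theorem continuousAt_unif {v : Fin (p + 1) → ℂ} (hv : v ∈ D.cone) : ContinuousAt D.unif v :=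
  D.continuousOn_unif.continuousAt ((isOpen_negCone _).mem_nhds hv)

end Action

/-! ### The fibres of a level covering -/

section Fibres

variable (hH : D₁.Hℂ = D₂.Hℂ) (f : C(ComplexPoints X₁, ComplexPoints X₂))
  (hf : ∀ v ∈ D₁.cone, f (D₁.unif v) = D₂.unif v)

include hH in
/-- Two data with the same hermitian space have the same negative cone. [folklore] -/
private theorem cone_eq_of_Hℂ_eq : D₁.cone = D₂.cone :=
  congrArg negCone hH

include hH hf in
/-- The points `unif₁ (γ • v)`, `γ ∈ Γ₂`, lie over `unif₂ v`.
[cite: BergeronMillsonMoeglin2016Balls, Part 2 §1.3] -/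
theorem apply_unif_act {γ : GL (Fin (2 + 1)) D₂.E} (hγ : γ ∈ D₂.Γ) {v : Fin (2 + 1) → ℂ}
    (hv : v ∈ D₂.cone) : f (D₁.unif (D₂.act γ v)) = D₂.unif v := by
  have hc : D₂.act γ v ∈ D₁.cone := by
    rw [cone_eq_of_Hℂ_eq hH]
    exact D₂.act_mem_cone hγ hv
  rw [hf _ hc, ((D₂.unif_eq_unif_iff v hv (D₂.act γ v) (D₂.act_mem_cone hγ hv)).2
    ⟨γ, hγ, 1, one_ne_zero, (one_smul ℂ _).symm⟩).symm]

include hH hf in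
/-- **The fibre of the level covering over `unif₂ v` is `{unif₁ (γ • v) : γ ∈ Γ₂}`** (both
quotients are orbit spaces of the same cone: `unif_eq_unif_iff`).
[cite: BergeronMillsonMoeglin2016Balls, Introduction §1.1] -/
theorem mem_preimage_unif_iff {v : Fin (2 + 1) → ℂ} (hv : v ∈ D₂.cone) (e : ComplexPoints X₁) :
    f e = D₂.unif v ↔ ∃ γ ∈ D₂.Γ, e = D₁.unif (D₂.act γ v) := by
  constructor
  · intro he
    obtain ⟨w, hw, rfl⟩ := D₁.surjOn_unif (Set.mem_univ e)
    have hw₁ : w ∈ D₁.cone := hw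
    have hw₂ : w ∈ D₂.cone := by
      rw [← cone_eq_of_Hℂ_eq hH]
      exact hw₁
    rw [hf w hw₁] at he
    obtain ⟨γ, hγ, a, ha, hγw⟩ := (D₂.unif_eq_unif_iff w hw₂ v hv).1 he
    have hγw' : D₂.act γ w = a • v := hγw
    refine ⟨γ⁻¹, inv_mem hγ, ?_⟩
    have hw' : w = D₂.act γ⁻¹ (a • v) := by
      rw [← hγw', act_inv_act]
    have hc : D₂.act γ⁻¹ v ∈ D₁.cone := by
      rw [cone_eq_of_Hℂ_eq hH]
      exact D₂.act_mem_cone (inv_mem hγ) hv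
    rw [hw', act_smul_vec, D₁.unif_smul ha hc]
  · rintro ⟨γ, hγ, rfl⟩
    exact apply_unif_act hH f hf hγ hv

include hH hf in
/-- `unif₁ (γ • v)` is in the (finite) fibre of the covering over `unif₂ v`.
[cite: BergeronMillsonMoeglin2016Balls, Part 2 §1.3] -/
theorem unif_act_mem_fibre (c : IsFiniteCover f) {γ : GL (Fin (2 + 1)) D₂.E} (hγ : γ ∈ D₂.Γ)
    {v : Fin (2 + 1) → ℂ} (hv : v ∈ D₂.cone) : D₁.unif (D₂.act γ v) ∈ c.fibre (D₂.unif v) := by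
  rw [IsFiniteCover.mem_fibre]
  exact apply_unif_act hH f hf hγ hv

variable (D₁ D₂) in
/-- A choice, for a point `e` of `X₁(ℂ)` and `v₀` in the cone, of `γ_e ∈ Γ₂` with
`unif₁ (γ_e • v₀) = e` (junk if `e` is not in the fibre over `unif₂ v₀`). [folklore] -/
def fibreRep (v₀ : Fin (2 + 1) → ℂ) (e : ComplexPoints X₁) : GL (Fin (2 + 1)) D₂.E :=
  Classical.epsilon fun γ ↦ γ ∈ D₂.Γ ∧ D₁.unif (D₂.act γ v₀) = e

include hH hf in
/-- The defining property of `fibreRep` on the fibre. [folklore] -/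
private theorem fibreRep_spec {v₀ : Fin (2 + 1) → ℂ} (hv₀ : v₀ ∈ D₂.cone) {e : ComplexPoints X₁}
    (he : f e = D₂.unif v₀) :
    fibreRep D₁ D₂ v₀ e ∈ D₂.Γ ∧ D₁.unif (D₂.act (fibreRep D₁ D₂ v₀ e) v₀) = e := by
  obtain ⟨γ, hγ, hγe⟩ := (mem_preimage_unif_iff hH f hf hv₀ e).1 he
  exact Classical.epsilon_spec (p := fun γ ↦ γ ∈ D₂.Γ ∧ D₁.unif (D₂.act γ v₀) = e) ⟨γ, hγ, hγe.symm⟩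

include hH in
/-- `v ↦ unif₁ (γ • v)` is continuous at points of the cone, for `γ ∈ Γ₂`. [folklore] -/
private theorem continuousAt_unif_act {γ : GL (Fin (2 + 1)) D₂.E} (hγ : γ ∈ D₂.Γ) {v₀ : Fin (2 + 1) → ℂ}
    (hv₀ : v₀ ∈ D₂.cone) : ContinuousAt (fun v ↦ D₁.unif (D₂.act γ v)) v₀ := by
  have hc : D₂.act γ v₀ ∈ D₁.cone := by
    rw [cone_eq_of_Hℂ_eq hH]
    exact D₂.act_mem_cone hγ hv₀
  exact (D₁.continuousAt_unif hc).comp (D₂.continuous_act_vec γ).continuousAt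

/-- `X(ℂ)` is path connected for a ball quotient (`X` smooth projective: connected, and locally
path connected as a manifold). [cite: SerreGAGA1956, §2 n°5 Prop. 2 and n°6] -/
theorem pathConnectedSpace_complexPoints (D : UnitaryBallUniformisationDatum 2 X₂) :
    PathConnectedSpace (ComplexPoints X₂) := by
  haveI := HodgeTheory.connectedSpace_complexPoints D.isSmoothProjective
  letI := D.isSmoothProjective.chartedSpace
  haveI : LocallyPathConnectedSpace (ComplexPoints X₂) :=
    ChartedSpace.locallyPathConnectedSpace (H := EuclideanSpace ℝ (Fin (2 * 2)))
      (M := ComplexPoints X₂)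
  exact pathConnectedSpace_iff_connectedSpace.2 inferInstance

open scoped Classical in
include hH hf in
/-- **Local structure of the fibres.** Near `v₀`, the points `unif₁ (γ_e • v)`, `e ∈ f⁻¹(unif₂ v₀)`,
are pairwise distinct and form the whole fibre over `unif₂ v`.
[cite: BergeronMillsonMoeglin2016Balls, Part 2 §1.3] [cite: HatcherAT2002, §1.3 p. 61] -/
theorem eventually_fibre_eq_image (c : IsFiniteCover f) {v₀ : Fin (2 + 1) → ℂ}
    (hv₀ : v₀ ∈ D₂.cone) :
    ∀ᶠ v in 𝓝 v₀, v ∈ D₂.cone ∧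
      Set.InjOn (fun e ↦ D₁.unif (D₂.act (fibreRep D₁ D₂ v₀ e) v)) ↑(c.fibre (D₂.unif v₀)) ∧
      c.fibre (D₂.unif v) =
        (c.fibre (D₂.unif v₀)).image fun e ↦ D₁.unif (D₂.act (fibreRep D₁ D₂ v₀ e) v) := by
  classical
  haveI := D₁.t2Space_complexPoints
  haveI := pathConnectedSpace_complexPoints D₂
  set S := c.fibre (D₂.unif v₀) with hS
  set ρ := fibreRep D₁ D₂ v₀ with hρ
  have hspec : ∀ e ∈ S, ρ e ∈ D₂.Γ ∧ D₁.unif (D₂.act (ρ e) v₀) = e := fun e he ↦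
    fibreRep_spec hH f hf hv₀ ((IsFiniteCover.mem_fibre c).1 he)
  -- (1) the cone is open
  have h1 : ∀ᶠ v in 𝓝 v₀, v ∈ D₂.cone := (isOpen_negCone _).mem_nhds hv₀
  -- (2) pairwise distinctness propagates from `v₀` (Hausdorffness + continuity)
  have h2 : ∀ᶠ v in 𝓝 v₀, ∀ q ∈ S ×ˢ S, q.1 ≠ q.2 →
      D₁.unif (D₂.act (ρ q.1) v) ≠ D₁.unif (D₂.act (ρ q.2) v) := by
    refine (Filter.eventually_all_finset (S ×ˢ S)).2 fun q hq ↦ ?_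
    obtain ⟨h₁, h₂⟩ := Finset.mem_product.1 hq
    by_cases hne : q.1 = q.2
    · exact Filter.Eventually.of_forall fun v h ↦ (h hne).elim
    · have hne' : D₁.unif (D₂.act (ρ q.1) v₀) ≠ D₁.unif (D₂.act (ρ q.2) v₀) := by
        rw [(hspec _ h₁).2, (hspec _ h₂).2]
        exact hne
      obtain ⟨O₁, O₂, hO₁, hO₂, hm₁, hm₂, hdisj⟩ := t2_separation hne'
      have e₁ := (continuousAt_unif_act hH (hspec _ h₁).1 hv₀).eventually (hO₁.mem_nhds hm₁)
      have e₂ := (continuousAt_unif_act hH (hspec _ h₂).1 hv₀).eventually (hO₂.mem_nhds hm₂)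
      filter_upwards [e₁, e₂] with v hv₁ hv₂ _ heq
      exact Set.disjoint_left.1 hdisj hv₁ (heq ▸ hv₂)
  filter_upwards [h1, h2] with v hv hdist
  have hinj : Set.InjOn (fun e ↦ D₁.unif (D₂.act (ρ e) v)) ↑S := by
    intro e he e' he' heq
    by_contra hne
    exact hdist (e, e') (Finset.mem_product.2 ⟨he, he'⟩) hne heq
  refine ⟨hv, hinj, ?_⟩
  -- (3) the image lies in the fibre over `unif₂ v` and has the full cardinality
  have hsub : S.image (fun e ↦ D₁.unif (D₂.act (ρ e) v)) ⊆ c.fibre (D₂.unif v) := by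
    intro e' he'
    obtain ⟨e, he, rfl⟩ := Finset.mem_image.1 he'
    exact unif_act_mem_fibre hH f hf c (hspec e he).1 hv
  have hcard : (c.fibre (D₂.unif v)).card ≤ (S.image fun e ↦ D₁.unif (D₂.act (ρ e) v)).card := by
    rw [Finset.card_image_of_injOn hinj, hS, c.card_fibre_eq (D₂.unif v₀) (D₂.unif v)]
  exact (Finset.eq_of_subset_of_card_le hsub hcard).symm

open scoped Classical in
include hH hf in
/-- **The local coset formula for the norm along a level covering**: for `v` near `v₀`,
`N_f Φ (unif₂ v) = ∏_{e ∈ f⁻¹(unif₂ v₀)} Φ (unif₁ (γ_e • v))`.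
[cite: MumfordAV1970, §6] [cite: BergeronMillsonMoeglin2016Balls, Part 2 §1.3] -/
theorem normMap_unif_eventuallyEq (c : IsFiniteCover f) {G : Type} [CommMonoid G]
    [TopologicalSpace G] [ContinuousMul G] (Φ : C(ComplexPoints X₁, G)) {v₀ : Fin (2 + 1) → ℂ}
    (hv₀ : v₀ ∈ D₂.cone) :
    (fun v ↦ c.normMap Φ (D₂.unif v)) =ᶠ[𝓝 v₀]
      fun v ↦ ∏ e ∈ c.fibre (D₂.unif v₀), Φ (D₁.unif (D₂.act (fibreRep D₁ D₂ v₀ e) v)) := by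
  classical
  filter_upwards [eventually_fibre_eq_image hH f hf c hv₀] with v ⟨_, hinj, heq⟩
  rw [IsFiniteCover.normMap_apply, heq, Finset.prod_image hinj]

end Fibres

/-! ### The norm of a morphism to an abelian variety is holomorphic -/

section Holomorphy

variable (hH : D₁.Hℂ = D₂.Hℂ) (f : C(ComplexPoints X₁, ComplexPoints X₂))
  (hf : ∀ v ∈ D₁.cone, f (D₁.unif v) = D₂.unif v) (c : IsFiniteCover f)
  {A : AbelianVariety ℂ} {n : ℕ} (hAn : IsSmoothProjective n A.X)
  (A₂ : HodgeModel 2 X₂) (B : HodgeModel n A.X) (F : X₁ ⟶ A.X)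

/-- **The norm of `F : X₁ ⟶ A` along the level covering, read in Hodge models**:
`x ↦ (A^an ≃ₜ A(ℂ))⁻¹ (N_f F(ℂ) (x))`, a map `X₂^an → A^an`. [cite: MumfordAV1970, §6] -/
def normAn (c : IsFiniteCover f) (A₂ : HodgeModel 2 X₂) (B : HodgeModel n A.X) (F : X₁ ⟶ A.X) :
    A₂.carrier → B.carrier :=
  fun x ↦ B.isAnalytification.homeomorph.symm
    (c.normMap (AlgPoints.mapContinuous (L := ℂ) F) (A₂.toComplexPoints x))

/-- `normAn` lies over the norm `N_f F(ℂ)`. [folklore] -/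
private theorem toComplexPoints_normAn (x : A₂.carrier) :
    B.toComplexPoints (normAn f c A₂ B F x) =
      c.normMap (AlgPoints.mapContinuous (L := ℂ) F) (A₂.toComplexPoints x) :=
  B.isAnalytification.homeomorph.apply_symm_apply _

/-- `normAn` is continuous. [folklore] -/
private theorem continuous_normAn : Continuous (normAn f c A₂ B F) :=
  B.isAnalytification.homeomorph.symm.continuous.comp
    ((c.normMap _).continuous.comp A₂.isAnalytification.isHomeomorph.continuous)

include hH in
/-- **The local product `v ↦ ∏_e F(unif₁(γ_e • v))` is a holomorphic family** in the commutative
group scheme `A` on a neighbourhood of `v₀`: each factor is `F ∘ unif₁ ∘ (γ_e •)`, holomorphic by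
`differentiableOn_unif` and the affine criterion, and finite products of holomorphic families are
holomorphic (Mumford §1 (1)). [cite: SerreGAGA1956, §2 n°5 p. 9] [cite: MumfordAV1970, §1 (1)] -/
theorem exists_isHolFamilyOn_prod (S : Finset (ComplexPoints X₁))
    (ρ : ComplexPoints X₁ → GL (Fin (2 + 1)) D₂.E)
    (hρ : ∀ e ∈ S, ρ e ∈ D₂.Γ) {v₀ : Fin (2 + 1) → ℂ} (hv₀ : v₀ ∈ D₂.cone) :
    ∃ W : Set (Fin (2 + 1) → ℂ), IsOpen W ∧ v₀ ∈ W ∧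
      AlgPoints.IsHolFamilyOn W fun v ↦ ∏ e ∈ S, AlgPoints.map F (D₁.unif (D₂.act (ρ e) v)) := by
  classical
  -- an affine open `V e ∋ unif₁ (γ_e • v₀)` for each `e`, and the open set above it in the cone
  have hc : ∀ e ∈ S, D₂.act (ρ e) v₀ ∈ D₁.cone := fun e he ↦ by
    rw [cone_eq_of_Hℂ_eq hH]
    exact D₂.act_mem_cone (hρ e he) hv₀
  choose V hV hmem using fun e : ComplexPoints X₁ ↦
    exists_isAffineOpen_mem_and_subset (X := X₁.left) (x := (D₁.unif (D₂.act (ρ e) v₀)).pt)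
      (U := ⊤) trivial
  let U : ComplexPoints X₁ → Set (Fin (2 + 1) → ℂ) := fun e ↦
    D₁.cone ∩ D₁.unif ⁻¹' {P | P.pt ∈ V e}
  have hUo : ∀ e, IsOpen (U e) := fun e ↦
    D₁.continuousOn_unif.isOpen_inter_preimage (isOpen_negCone _)
      (AlgPoints.isOpen_setOf_pt_mem (V e))
  -- `unif₁` is a holomorphic family on `U e` (affine criterion)
  have hhol : ∀ e, AlgPoints.IsHolFamilyOn (U e) D₁.unif := fun e ↦
    AlgPoints.isHolFamilyOn_of_differentiableOn_evalOrZero (V e) D₁.unif (fun u hu ↦ hu.2)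
      (fun s ↦ D₁.differentiableOn_unif ⟨V e, hV e⟩ s) (hV e)
  -- the common open neighbourhood of `v₀`
  let W : Set (Fin (2 + 1) → ℂ) := ⋂ e ∈ S, D₂.act (ρ e) ⁻¹' U e
  have hWo : IsOpen W :=
    isOpen_biInter_finset fun e _ ↦ (hUo e).preimage (D₂.continuous_act_vec (ρ e))
  have hW₀ : v₀ ∈ W := Set.mem_iInter₂.2 fun e he ↦ ⟨hc e he, (hmem e).1⟩
  refine ⟨W, hWo, hW₀, AlgPoints.IsHolFamilyOn.finsetProd S fun e he ↦ ?_⟩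
  have h₁ : AlgPoints.IsHolFamilyOn (D₂.act (ρ e) ⁻¹' U e) (D₁.unif ∘ D₂.act (ρ e)) :=
    (hhol e).comp (D₂.act (ρ e)) (D₂.differentiable_act_vec (ρ e)).differentiableOn
      (Set.mapsTo_preimage _ _)
  exact (h₁.map F).mono (Set.biInter_subset_of_mem he)

include hH hf hAn in
/-- **The norm of a morphism to an abelian variety along a level covering is holomorphic**
(as a map of the analytifications `X₂^an → A^an`). Near `x = ψ₂ z` write `x' = ψ₂ (g (φ x'))` with
`g` a holomorphic local inverse of the uniformization in the chart `φ` (`ChartInverse`); then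
`normAn x' = N (unif₂ (T (g (φ x'), 1)))`, and `v ↦ N (unif₂ v)` is holomorphic into `A^an` because
its regular coordinates are those of the holomorphic family `v ↦ ∏_e F(unif₁(γ_e • v))` (local coset
formula). [cite: SerreGAGA1956, §2 n°5 p. 9 and n°6 Prop. 3 Cor. 2] [cite: MumfordAV1970, §6]
[cite: FritzscheGrauert2002, Ch. I §8 Cor. 8.6] -/
theorem mdifferentiable_normAn :
    MDifferentiable 𝓘(ℂ, A₂.model) 𝓘(ℂ, B.model) (normAn f c A₂ B F) := by
  classical
  haveI := hAn.smoothOfRelativeDimension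
  intro x
  obtain ⟨𝔣⟩ := D₂.nonempty_sylvesterFrame
  obtain ⟨z, hz⟩ := D₂.exists_modelUnif_eq A₂ 𝔣 x
  obtain ⟨cI⟩ := D₂.nonempty_chartInverse A₂ 𝔣 z
  set φ := extChartAt 𝓘(ℂ, A₂.model) x with hφ
  have hcenter : φ x ∈ cI.W := by
    rw [hφ, ← hz]
    exact cI.center_mem
  -- notation: the frame lift `L`, the norm `N`, and `k v = (A^an ≃ A(ℂ))⁻¹ (N (unif₂ v))`
  set L : (Fin 2 → ℂ) → (Fin (2 + 1) → ℂ) := fun w ↦ 𝔣.t *ᵥ ![w 0, w 1, 1] with hL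
  set N := c.normMap (AlgPoints.mapContinuous (L := ℂ) F) with hN
  set k : (Fin (2 + 1) → ℂ) → B.carrier :=
    fun v ↦ B.isAnalytification.homeomorph.symm (N (D₂.unif v))
    with hk
  have hψ : ∀ w : Fin 2 → ℂ, A₂.toComplexPoints (D₂.modelUnif A₂ 𝔣 w) = D₂.unif (L w) :=
    fun w ↦ A₂.isAnalytification.homeomorph.apply_symm_apply _
  -- `normAn = k ∘ L ∘ g ∘ φ` near `x`
  have key : normAn f c A₂ B F =ᶠ[𝓝 x] fun x' ↦ k (L (cI.g (φ x'))) := by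
    have h1 : ∀ᶠ x' in 𝓝 x, x' ∈ (chartAt A₂.model x).source :=
      (chartAt A₂.model x).open_source.mem_nhds (mem_chart_source _ x)
    have h2 : ∀ᶠ x' in 𝓝 x, φ x' ∈ cI.W :=
      (continuousAt_extChartAt (I := 𝓘(ℂ, A₂.model)) x).eventually (cI.isOpen.mem_nhds hcenter)
    filter_upwards [h1, h2] with x' hx₁ hx₂
    have hsrc : x' ∈ φ.source := by rwa [hφ, extChartAt_source]
    have hx' : x' = D₂.modelUnif A₂ 𝔣 (cI.g (φ x')) := by
      rw [← cI.symm_eq (φ x') hx₂, hz]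
      exact (φ.left_inv hsrc).symm
    change B.isAnalytification.homeomorph.symm (N (A₂.toComplexPoints x')) =
      B.isAnalytification.homeomorph.symm (N (D₂.unif (L (cI.g (φ x')))))
    rw [← hψ, ← hx']
  refine MDifferentiableAt.congr_of_eventuallyEq ?_ key
  -- the point `v₁ = L (g (φ x))` of the cone over `x`
  have hball : cI.g (φ x) ∈ BallForms.ballSet := cI.mapsTo hcenter
  have hv₁ : L (cI.g (φ x)) ∈ D₂.cone := (D₂.coneLift 𝔣 ⟨cI.g (φ x), hball⟩).2
  -- `k` is holomorphic at every point of the cone: test on regular functions of `A`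
  have hkd : ∀ {v₁ : Fin (2 + 1) → ℂ}, v₁ ∈ D₂.cone →
      MDifferentiableAt 𝓘(ℂ, Fin (2 + 1) → ℂ) 𝓘(ℂ, B.model) k v₁ := by
    intro v₁ hv₁
    have hcont : ContinuousAt k v₁ :=
      B.isAnalytification.homeomorph.symm.continuous.continuousAt.comp
        (N.continuous.continuousAt.comp (D₂.continuousAt_unif hv₁))
    refine B.isAnalytification.mdifferentiableAt_of_comp_regular hcont ?_
    intro V hV hQ s
    have hkψ : ∀ v, B.toComplexPoints (k v) = N (D₂.unif v) := fun v ↦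
      B.isAnalytification.homeomorph.apply_symm_apply _
    simp only [hkψ] at hQ ⊢
    rw [mdifferentiableAt_iff_differentiableAt]
    -- the local coset formula at `v₁`
    set S := c.fibre (D₂.unif v₁) with hS
    set ρ := fibreRep D₁ D₂ v₁ with hρ
    have hρΓ : ∀ e ∈ S, ρ e ∈ D₂.Γ := fun e he ↦
      (fibreRep_spec hH f hf hv₁ ((IsFiniteCover.mem_fibre c).1 he)).1
    have hloc := normMap_unif_eventuallyEq hH f hf c (AlgPoints.mapContinuous (L := ℂ) F) hv₁
    obtain ⟨W, hWo, hW₁, hfam⟩ := exists_isHolFamilyOn_prod hH F S ρ hρΓ hv₁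
    set Gf : (Fin (2 + 1) → ℂ) → ComplexPoints A.X := fun v ↦
      ∏ e ∈ S, AlgPoints.map F (D₁.unif (D₂.act (ρ e) v)) with hGf
    have hGN : ∀ᶠ v in 𝓝 v₁, N (D₂.unif v) = Gf v := by
      filter_upwards [hloc] with v hv
      rw [hv]
      rfl
    have hG₁ : N (D₂.unif v₁) = Gf v₁ := hGN.self_of_nhds
    -- regular functions are holomorphic along the holomorphic family `Gf`
    have hd : DifferentiableOn ℂ (fun v ↦ AlgPoints.evalOrZero V s (Gf v))
        (W ∩ Gf ⁻¹' {Q | Q.pt ∈ V}) :=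
      hfam.differentiableOn_evalOrZero hWo V s
    have hO : IsOpen (W ∩ Gf ⁻¹' {Q | Q.pt ∈ V}) := hfam.isOpen_inter_preimage hWo V
    have hm : v₁ ∈ W ∩ Gf ⁻¹' {Q | Q.pt ∈ V} := ⟨hW₁, by
      show (Gf v₁).pt ∈ V
      rw [← hG₁]
      exact hQ⟩
    refine ((hd.differentiableAt (hO.mem_nhds hm)).congr_of_eventuallyEq ?_)
    filter_upwards [hGN] with v hv
    rw [hv]
  -- assemble: `k ∘ L ∘ g ∘ φ`
  have hφd : MDifferentiableAt 𝓘(ℂ, A₂.model) 𝓘(ℂ, A₂.model) φ x :=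
    mdifferentiableAt_extChartAt (mem_chart_source _ x)
  have hg : MDifferentiableAt 𝓘(ℂ, A₂.model) 𝓘(ℂ, Fin 2 → ℂ) cI.g (φ x) :=
    mdifferentiableAt_iff_differentiableAt.2 (cI.differentiableAt hcenter)
  have hLd : MDifferentiableAt 𝓘(ℂ, Fin 2 → ℂ) 𝓘(ℂ, Fin (2 + 1) → ℂ) L (cI.g (φ x)) :=
    mdifferentiableAt_iff_differentiableAt.2 (D₂.differentiable_frameLift 𝔣 _)
  have hcomp : MDifferentiableAt 𝓘(ℂ, A₂.model) 𝓘(ℂ, B.model) (k ∘ (L ∘ (cI.g ∘ φ))) x :=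
    (hkd hv₁).comp x (hLd.comp x (hg.comp x hφd))
  exact hcomp

/-! ### Algebraicity of the norm (GAGA) and the `H¹` identity -/

include hH hf hAn A₂ B in
/-- **The norm of a morphism to an abelian variety along a level covering is a morphism** (under
the record `Arapura2012_Cor_15_4_6`: a holomorphic map between nonsingular projective varieties is
algebraic; `X₂` is smooth projective by the datum and `A` is by
`AbelianVariety.isSmoothProjective_holds`): there is `N : X₂ ⟶ A` over `ℂ` with
`N(ℂ) = N_f (F(ℂ))`, the norm of `F(ℂ)` along `f`. The Hodge models are inputs; the conclusion
does not mention them. [cite: Arapura2012, §15.4 Cor. 15.4.6] [cite: MumfordAV1970, §6] -/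
theorem exists_hom_eq_normMap (hA : Arapura2012_Cor_15_4_6) :
    ∃ N : X₂ ⟶ A.X, AlgPoints.mapContinuous (L := ℂ) N =
      c.normMap (AlgPoints.mapContinuous (L := ℂ) F) := by
  obtain ⟨g, hg⟩ := hA X₂ A.X D₂.isSmoothProjective hAn A₂.model A₂.carrier A₂.toComplexPoints
    A₂.isAnalytification B.model B.carrier B.toComplexPoints B.isAnalytification
    (normAn f c A₂ B F) (mdifferentiable_normAn hH f hf c hAn A₂ B F)
  refine ⟨g, ContinuousMap.ext fun Q ↦ ?_⟩
  have h := hg (A₂.isAnalytification.homeomorph.symm Q)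
  rw [toComplexPoints_normAn] at h
  have h' : A₂.toComplexPoints (A₂.isAnalytification.homeomorph.symm Q) = Q :=
    A₂.isAnalytification.homeomorph.apply_symm_apply _
  rw [h'] at h
  rw [AlgPoints.mapContinuous_apply, ← h]

include hH hf c hAn A₂ B F in
/-- **The norm morphism** `N_f F : X₂ ⟶ A` of `F : X₁ ⟶ A` along the level covering `f` (a choice
of the morphism provided by `exists_hom_eq_normMap`). [cite: MumfordAV1970, §6]
[cite: Arapura2012, §15.4 Cor. 15.4.6] -/
def normHom (hA : Arapura2012_Cor_15_4_6) : X₂ ⟶ A.X :=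
  (exists_hom_eq_normMap hH f hf c hAn A₂ B F hA).choose

/-- `(N_f F)(ℂ)` is the norm of `F(ℂ)` along `f`. [cite: MumfordAV1970, §6] -/
theorem mapContinuous_normHom (hA : Arapura2012_Cor_15_4_6) :
    AlgPoints.mapContinuous (L := ℂ) (normHom hH f hf c hAn A₂ B F hA) =
      c.normMap (AlgPoints.mapContinuous (L := ℂ) F) :=
  (exists_hom_eq_normMap hH f hf c hAn A₂ B F hA).choose_spec

/-- Pointwise form: `(N_f F)(ℂ)(Q) = ∏_{f e = Q} F(ℂ)(e)`. [cite: MumfordAV1970, §6] -/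
theorem map_normHom_apply (hA : Arapura2012_Cor_15_4_6) (Q : ComplexPoints X₂) :
    AlgPoints.map (normHom hH f hf c hAn A₂ B F hA) Q = ∏ e ∈ c.fibre Q, AlgPoints.map F e := by
  have h := congrArg (fun g : C(ComplexPoints X₂, ComplexPoints A.X) ↦ g Q)
    (mapContinuous_normHom hH f hf c hAn A₂ B F hA)
  simpa only [AlgPoints.mapContinuous_apply, IsFiniteCover.normMap_apply] using h

/-- **The transfer along a level covering is induced by the norm morphism in `H¹(–; ℚ)`**:
`[X₁(ℂ) : X₂(ℂ)] • τ (F(ℂ)^* a) = (N_f F)(ℂ)^* a` for `a ∈ H¹(A(ℂ); ℚ)` (the number of sheets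
`IsFiniteCover.sheets` as the scalar, the normalised transfer `IsFiniteCover.transferMap`).
[cite: HatcherAT2002, §3.G p. 321] [cite: MumfordAV1970, §6] -/
theorem sheets_smul_transferMap_pull_eq (hA : Arapura2012_Cor_15_4_6)
    (a : singularCohomology ℚ ℚ (ComplexPoints A.X) 1) :
    (c.sheets : ℚ) • c.transferMap (R := ℚ) 1
        (singularCohomology.map ℚ ℚ (AlgPoints.mapContinuous (L := ℂ) F) 1 a) =
      singularCohomology.map ℚ ℚ
        (AlgPoints.mapContinuous (L := ℂ) (normHom hH f hf c hAn A₂ B F hA)) 1 a := by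
  haveI := pathConnectedSpace_complexPoints D₂
  haveI := D₂.nonempty_complexPoints
  obtain ⟨b⟩ := (inferInstance : Nonempty (ComplexPoints X₂))
  rw [mapContinuous_normHom]
  exact c.sheets_smul_transferMap_map (AlgPoints.mapContinuous (L := ℂ) F) b a

end Holomorphy

end UnitaryBallUniformisationDatum

end Literature.AlgebraicGeometry.ShimuraVarieties

end
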